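import Summits.BirchSwinnertonDyer.Rank1Residual.SmallImageMu.TorsionPointFieldMu
import Summits.BirchSwinnertonDyer.Rank1Residual.SmallImageMu.TransportByName
import HarnessLib
import HarnessLib.Audit

/-!
# Kernel edges of the descent-lens nodes `TorsionPointFieldMuSufficesOnClassX9` (DESC-C1′) and
# `ClassicalMuSufficesOnClassX9` (DESC-C1): both are implied by Greenberg's conjecture on X9 and by
# items 19629 ∧ 19630; DESC-C1′ + per-pair class-group certificates + 19630 ⟹ the integral main
# conjecture on X9 (granted BCS (a))

HONEST FRAMING (cell `bsd-f3-mu`).  THEOREMS ONLY, sorry-free; nothing booked; every statement is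
conditional on the open nodes named in its hypotheses and/or on PUBLISHED named facts taken as binders
(`hBCS` = BCS 2025 Thm 1.1.2 (a), `hmodP` = modularity).  Content (REF1-AUDIT §3.1.desc: «STRUCTURE:
hypothesis-decorated weakening of "μ^alg = 0 on X9" (kernel one-liner)»): the two nodes are
`(∀ X9 pairs, MuAlgZeroAt) ∘ (drop the class-group hypothesis)`, and `∀ X9 pairs, MuAlgZeroAt` follows
from `GreenbergMuConjectureIrreducible` (`SmallImageMu.muAlgZeroAt_of_greenbergMuConjectureIrreducible_of_classX9`,
torsion from BCS (a)) and from `KatoMuTransfer ∧ AnalyticMuZeroOnClassX9` (`SmallImageMu.muAlgZeroAt_of_classX9`).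
Conversely, toward the summit: DESC-C1′ decides `μ(Sel) = 0` at every X9 pair carrying a class-group
certificate for some `ℚ(P)` (Fukuda, `IwasawaTheory.classicalMuVanishes_of_classGroupPRank_succ_eq`), and
then item 19630's unit coefficient + BCS (a) + GV Prop. 3.7 give the integral main conjecture there
(`Rank1Residual.mazurMainConjecture_of_mu_eq_zero`) — `integralMainConjectureOnClassX9_of_torsionPointFieldMu`,
with the certificates as an explicit class-wide hypothesis (`hcert`; it is what `-data`'s column (d6)
would have to supply pair by pair — NOT asserted).  DESC-C1′ ⟹ DESC-C1 is NOT proved (needs `μ = 0` to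
descend from `ℚ(E[p])` to `ℚ(P)`, a number-field lemma not in the tree).

References: [Ray2023] Thm. 2, Conj. 5.3; [GreenbergLNM1716] Conj. 1.11; [BurungaleCastellaSkinner2025]
Thm. 1.1.2 (a); [GreenbergVatsal2000] Prop. 3.7; HOME MEMO-desc.md §2–§6, REF1-AUDIT.md §3.1.desc.
-/

-- the summit and its single problem are both named `BirchSwinnertonDyer` (registry layout D-0017)
set_option linter.dupNamespace false

noncomputable section

open scoped Classical MatrixGroups ModularForm

open CongruenceSubgroup WeierstrassCurve Literature.NumberTheory.EllipticCurves
  Literature.NumberTheory.EllipticCurves.ModularForms Literature.NumberTheory.IwasawaTheory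
  Summit.BirchSwinnertonDyer.BirchSwinnertonDyer.Rank1Residual
open Literature.NumberTheory.EllipticCurves.Rank1Residual (MuAlgZeroAt mazurMainConjecture_of_mu_eq_zero)

namespace Summit.BirchSwinnertonDyer.Rank1Residual.SmallImageMu

/-! ## §1 The nodes are implied by Greenberg-X9 and by 19629 ∧ 19630 -/

/-- **Greenberg's Conj. 1.11 (irreducible form) ⟹ DESC-C1′** (granted BCS (a) for `Λ`-torsion and
modularity for a newform): the class-group hypothesis is simply dropped.
[cite: GreenbergLNM1716, §1 Conj. 1.11 (p. 64)] -/
theorem torsionPointFieldMuSufficesOnClassX9_of_greenbergMuConjectureIrreducible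
    (hG : GreenbergMuConjectureIrreducible)
    (hBCS : burungale_castella_skinner_charIdeal_eq_padicLFunction)
    (hmodP : nonempty_modularParametrizationData) : TorsionPointFieldMuSufficesOnClassX9 :=
  fun _ _ _ _ _ hX9 _ => muAlgZeroAt_of_greenbergMuConjectureIrreducible_of_classX9 hG hBCS hmodP hX9

/-- **Greenberg's Conj. 1.11 (irreducible form) ⟹ DESC-C1** (same one-liner).
[cite: GreenbergLNM1716, §1 Conj. 1.11 (p. 64)] -/
theorem classicalMuSufficesOnClassX9_of_greenbergMuConjectureIrreducible
    (hG : GreenbergMuConjectureIrreducible)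
    (hBCS : burungale_castella_skinner_charIdeal_eq_padicLFunction)
    (hmodP : nonempty_modularParametrizationData) : ClassicalMuSufficesOnClassX9 :=
  fun _ _ _ _ _ hX9 _ => muAlgZeroAt_of_greenbergMuConjectureIrreducible_of_classX9 hG hBCS hmodP hX9

/-- **Items 19629 (`KatoMuTransfer`) ∧ 19630 (`AnalyticMuZeroOnClassX9`) ⟹ DESC-C1′** (through
`SmallImageMu.muAlgZeroAt_of_classX9`; modularity `hmodP` supplies a newform).
[cite: Kato2004Asterisque, Thm. 17.4 — the transfer's source] -/
theorem torsionPointFieldMuSufficesOnClassX9_of_katoMuTransfer_of_analyticMuZero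
    (hmodP : nonempty_modularParametrizationData) (hT : KatoMuTransfer)
    (hA : AnalyticMuZeroOnClassX9) : TorsionPointFieldMuSufficesOnClassX9 :=
  fun _ _ _ _ _ hX9 _ => muAlgZeroAt_of_classX9 hmodP hT hA hX9

/-- **Items 19629 ∧ 19630 ⟹ DESC-C1** (same). [cite: Kato2004Asterisque, Thm. 17.4] -/
theorem classicalMuSufficesOnClassX9_of_katoMuTransfer_of_analyticMuZero
    (hmodP : nonempty_modularParametrizationData) (hT : KatoMuTransfer)
    (hA : AnalyticMuZeroOnClassX9) : ClassicalMuSufficesOnClassX9 :=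
  fun _ _ _ _ _ hX9 _ => muAlgZeroAt_of_classX9 hmodP hT hA hX9

/-! ## §2 Toward the summit: DESC-C1′ + class-group certificates + 19630 ⟹ IMC on X9 -/

/-- **DESC-C1′ + a class-group certificate at EVERY X9 pair + item 19630 ⟹ the integral main
conjecture on class X9** (granted BCS (a)): per pair DESC-C1′ and the certificate give `μ(X) = 0`, and
`Rank1Residual.mazurMainConjecture_of_mu_eq_zero` (BCS (a) + GV Prop. 3.7 + the unit coefficient of
19630) pins `ch_Λ X = (L_p)`.  The certificate hypothesis `hcert` (for each X9 pair some nonzero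
`P ∈ E[p]` whose field `ℚ(P)` has classical `μ = 0` in growth form for every cyclotomic `κ` — what
Fukuda's criterion certifies from two class groups) is a CLASS-WIDE HYPOTHESIS, not asserted; this edge
records how the desc node would REPLACE item 19629 in the K6 assembly
`integralMainConjectureOnClassX9_of_katoMuTransfer`.
[cite: BurungaleCastellaSkinner2025, Thm. 1.1.2 (a) (p. 2 of arXiv:2405.00270v2)]
[cite: GreenbergVatsal2000, Prop. 3.7] -/
theorem integralMainConjectureOnClassX9_of_torsionPointFieldMu
    (hBCS : burungale_castella_skinner_charIdeal_eq_padicLFunction)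
    (hD : TorsionPointFieldMuSufficesOnClassX9) (hA : AnalyticMuZeroOnClassX9)
    (hcert : ∀ (W : WeierstrassCurve ℚ) [W.IsElliptic] [W.IsGloballyMinimal] (p : ℕ) [Fact p.Prime],
      ClassX9 W p →
      ∃ P : geomTorsion W (p : ℤ), P ≠ 0 ∧
        ∀ κ : ZpExtension
            (IntermediateField.fixedField (MulAction.stabilizer (Field.absoluteGaloisGroup ℚ) P)) p,
          κ.IsCyclotomic → ClassicalMuVanishes κ) :
    IntegralMainConjectureOnClassX9 := by
  intro W _ _ p _ κ γ N _ f hX9 hκ hγ hγ' hf D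
  obtain ⟨-, hp, hgood, hord, hirr, -⟩ := id hX9
  have hμ : D.mu = 0 := hD W p hX9 (hcert W p hX9) κ γ hκ hγ hγ' D
  exact mazurMainConjecture_of_mu_eq_zero hBCS W p hp hgood hord hirr κ γ hκ hγ hγ' f hf D hμ
    (hA W p f hX9 hf)

end Summit.BirchSwinnertonDyer.Rank1Residual.SmallImageMu

end
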